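import Summits.QuantumFields.YangMills.Theorems.FluctuationComparisonRegPrIntLBackgroundFormOfPolymerPackage
import HarnessLib

/-!
# CANONICAL CELL GEOMETRY — the geometry letters (d1)–(d6) + dictionary of the v2 background-form rows, DISCHARGED (hypothesis-free)

Cell `ym3-torus` (YM ladder rung R3 = continuum `SU(2)` Yang–Mills on the three-torus — a RUNG, NOT d = 4, NOT infinite volume, NOT a mass gap,
NOT Clay).  Crux of record `stmt-QuantumFields-20520` = `UnitScaleTilt.FluctuationComparisonRegPrIntL` (DECIDING); this file is a HELPER
(`--supports`), it closes nothing and registers nothing (★★OWNER RULING №36: organ-level lines are published, not registered).  Width seat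
`ym-ust-20520-w4` (gen 20); piece (GEOᵛ²) named by LEAD-20520 `w3` g21 (14:53:37Z).

WHAT.  The v2 rows of LINE g24-4 «background form» — BGFORM∘ v2 (`Cruxes/FluctuationComparisonRegPrIntL/Lines/background_form.lean` 22880983c54704f6 §1),
its analytic edition BGFORMᵃ∘ v2 (w5 g20, ✓`…BackgroundFormCellAnalyticKnit`) and the gas letter GASᵇᵍ∘ v2 (LEAD g21, `…BackgroundFormCellGasKnit`) — all
quantify EXISTENTIALLY over a symmetric pseudo-metric `d` on the COARSE (level-`J`) bonds with a volume-uniform summability constant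
(`Σ_{c′} e^{−μ d(c,c′)} ≤ C`, `C` chosen BEFORE the family `F` and the level `J`) and `κ·tdist_J ≤ μ·d`; GASᵇᵍ∘ v2 adds a DICTIONARY `ecb` of the coarse
bonds into the site torus `TPt 3 (Ncb·Mc)` of [Balaban1988RG2Cluster]'s cube system (cubes of side `Mc`) with `2μ·d(c,c′) ≤ (r₁∕2∕(Mc·3))·|ecb c − ecb c′|₁`
— the comparison under which lit ✓`sum_exp_torusTreeLen_two_sites_le` ((1.26) at two marked sites) delivers the two-pin decay.  ★`exists_cellGeometry`
INHABITS these geometry letters OUTRIGHT for the torus metric: `d := tdist_J` of bond sources, `ecb := e ∘ src` with `e` the `val`-preserving ℓ¹-isometry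
`Site (F.P J) 0 ≃ TPt 3 (Ncb·Mc)` of ✓`…PolymerTreeKnit.exists_siteEquiv_pl1` (so `tcubeOf Ncb Mc (ecb c)` IS the `Mc`-cube of `c.src` — last conjunct),
`μ := κ := r₁∕(4·Mc·3)` (so (d6) is an equality), `C := 3·K₁(3, μ)` by ✓`…BackgroundFormOfPolymerPackage.sum_bond_exp_neg_tdist_le` ([Balaban1987RG1] (5.10)
p.293: three bonds per site × the periodic ℓ¹ radial sum), uniformly in `F` and `J`; `Mc := 1` is always admissible (★`exists_cellGeometry_one`).
So an inhabitant of GASᵇᵍ∘ v2 ∕ BGFORMᵃ∘ v2 ∕ BGFORM∘ v2 owes only the analytic terms, the polymer gas and the response rows — the geometry clauses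
(d1)–(d6) and the dictionary are discharged here by `exact` (clause TEXTS token-identical to GASᵇᵍ∘ v2, HOME `ym-ust-20520-w3/g21/TEXT-GASbg-v2.w3g21.lean`
1669f1eacee7de38).

HONEST: plain lattice geometry (torus ℓ¹ isometry + radial sums); nothing of Bałaban's is asserted; it credits nothing toward the analytic ∕ gas ∕ response
letters, S2β, GRAD∘, the five registered ∘-stubs (v11.4, 0∕5) or `FluctuationComparisonRegPrIntL` (20520); `YM3TorusSU2` is NOT proved; rung R3 = SU(2) YM₃
on T³ — NOT d = 4, NOT infinite volume, NOT a mass gap, NOT Clay.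
-/

set_option autoImplicit false

noncomputable section

namespace Summit.QuantumFields.YangMills.Theorems.FluctuationComparisonRegPrIntLBackgroundFormCellGeometry

open scoped BigOperators
open Literature.MathematicalPhysics.QuantumFieldTheory.Balaban1983to89
open Literature.MathematicalPhysics.QuantumFieldTheory.Balaban1983to89.T3ContinuumYM3Torus
open Literature.MathematicalPhysics.QuantumFieldTheory.Balaban1983to89.TreeLengthTorus (TPt)
open Literature.MathematicalPhysics.QuantumFieldTheory.Balaban1983to89.B12Decay510Torus (pl1 pl1_sub_comm pl1_sub_triangle)
open Literature.MathematicalPhysics.QuantumFieldTheory.Balaban1983to89.B12Decay510Window (K₁ K₁_nonneg)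
open Summit.QuantumFields.YangMills.Theorems.FluctuationComparisonRegPrIntLPolymerTreeKnit (exists_siteEquiv_pl1)
open Summit.QuantumFields.YangMills.Theorems.FluctuationComparisonRegPrIntLBackgroundFormOfPolymerPackage (sum_bond_exp_neg_tdist_le)

/-- ★★★ **CANONICAL CELL GEOMETRY.**  For every cube side `Mc ≥ 1` and every rate `r₁ > 0` there are UNIFORM constants `κ = μ = r₁∕(4·Mc·3) > 0` and
`C = 3·K₁(3, μ)` such that for every family `F` and every level `J` with `Mc ∣ sitesPerDir`: the dictionary `ecb := e ∘ src` (`e` the `val`-preserving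
ℓ¹-isometry of the level-`J` site torus onto `TPt 3 (Ncb·Mc)`, `Ncb := sitesPerDir ∕ Mc`) and the pseudo-metric `d := tdist_J` of bond sources satisfy the
geometry letters of GASᵇᵍ∘ v2 ∕ BGFORMᵃ∘ v2 ∕ BGFORM∘ v2 VERBATIM — (d1) nonnegativity, (d2) symmetry, (d3) triangle, (d4) `Σ_y e^{−μ d(x,y)} ≤ C`, (d5)
`κ·tdist ≤ μ·d`, (d6) `2μ·d(c,c′) ≤ (r₁∕2∕(Mc·3))·|ecb c − ecb c′|₁` (an equality here) — and `(ecb c i).val = (c.src i).val` (the dictionary is the canonical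
one, so `tcubeOf Ncb Mc (ecb c)` is the `Mc`-cube of `c.src`). [cite: Balaban1987RG1, (5.10) p.293; Balaban1988RG2Cluster, (1.26) p.8] -/
theorem exists_cellGeometry (Mc : ℕ) [NeZero Mc] (r₁ : ℝ) (hr₁ : 0 < r₁) :
    ∃ (κ μ C : ℝ), 0 < κ ∧ 0 ≤ μ ∧ ∀ (F : T3Family) (J : ℕ), Mc ∣ (F.P J).sitesPerDir 0 →
      ∃ (Ncb : ℕ) (_ : NeZero Ncb) (ecb : PBond (F.P J) 0 → TPt 3 (Ncb * Mc)) (d : PBond (F.P J) 0 → PBond (F.P J) 0 → ℝ),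
        (∀ x y, 0 ≤ d x y) ∧ (∀ x y, d x y = d y x) ∧ (∀ x y z, d x z ≤ d x y + d y z) ∧
        (∀ x, ∑ y, Real.exp (-(μ * d x y)) ≤ C) ∧
        (∀ b b' : PBond (F.P J) 0, κ * (b.src.tdist b'.src : ℝ) ≤ μ * d b b') ∧
        (∀ c c' : PBond (F.P J) 0, 2 * μ * d c c' ≤ (r₁ / 2 / ((Mc : ℝ) * 3)) * pl1 (ecb c - ecb c')) ∧
        (∀ c : PBond (F.P J) 0, ∀ i : Fin 3, (ecb c i).val = (c.src i).val) := by
  have hMc : (0 : ℝ) < (Mc : ℝ) := by exact_mod_cast Nat.pos_of_neZero Mc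
  have hμ : (0 : ℝ) < r₁ / (4 * (Mc : ℝ) * 3) := by positivity
  refine ⟨r₁ / (4 * (Mc : ℝ) * 3), r₁ / (4 * (Mc : ℝ) * 3), 3 * K₁ 3 (r₁ / (4 * (Mc : ℝ) * 3)), hμ, hμ.le, fun F J hdvd => ?_⟩
  obtain ⟨k, hk⟩ := hdvd
  have hL : 0 < F.L := by have := F.hL.2; omega
  have hpos : 0 < (F.P J).sitesPerDir 0 := by
    show 0 < 2 * F.L ^ (F.m + J - 0)
    exact Nat.mul_pos (by norm_num) (pow_pos hL _)
  have hk0 : k ≠ 0 := by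
    rintro rfl
    rw [hk, mul_zero] at hpos
    exact lt_irrefl 0 hpos
  haveI : NeZero k := ⟨hk0⟩
  have h : (F.P J).sitesPerDir 0 = k * Mc := by rw [hk, mul_comm]
  obtain ⟨e, hval, he⟩ := exists_siteEquiv_pl1 F J h
  -- the clauses, stated beta-reduced for the witnesses `ecb := e ∘ src`, `d := tdist_J`
  have hd0 : ∀ x y : PBond (F.P J) 0, (0 : ℝ) ≤ (x.src.tdist y.src : ℝ) := fun x y => Nat.cast_nonneg _
  have hdsymm : ∀ x y : PBond (F.P J) 0, (x.src.tdist y.src : ℝ) = (y.src.tdist x.src : ℝ) := fun x y => by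
    rw [he, he, pl1_sub_comm]
  have hdtri : ∀ x y z : PBond (F.P J) 0, (x.src.tdist z.src : ℝ) ≤ (x.src.tdist y.src : ℝ) + (y.src.tdist z.src : ℝ) :=
    fun x y z => by rw [he, he, he]; exact pl1_sub_triangle _ _ _
  have hdsum : ∀ x : PBond (F.P J) 0,
      ∑ y : PBond (F.P J) 0, Real.exp (-(r₁ / (4 * (Mc : ℝ) * 3) * (x.src.tdist y.src : ℝ))) ≤ 3 * K₁ 3 (r₁ / (4 * (Mc : ℝ) * 3)) :=
    fun x => sum_bond_exp_neg_tdist_le F J hμ x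
  have hdcmp : ∀ b b' : PBond (F.P J) 0,
      r₁ / (4 * (Mc : ℝ) * 3) * (b.src.tdist b'.src : ℝ) ≤ r₁ / (4 * (Mc : ℝ) * 3) * (b.src.tdist b'.src : ℝ) := fun b b' => le_rfl
  have hdict : ∀ c c' : PBond (F.P J) 0,
      2 * (r₁ / (4 * (Mc : ℝ) * 3)) * (c.src.tdist c'.src : ℝ) ≤ (r₁ / 2 / ((Mc : ℝ) * 3)) * pl1 (e c.src - e c'.src) := by
    intro c c'
    rw [← he]
    apply le_of_eq
    field_simp
    ring
  have hvalc : ∀ c : PBond (F.P J) 0, ∀ i : Fin 3, (e c.src i).val = (c.src i).val := fun c i => hval c.src i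
  exact ⟨k, inferInstance, fun c => e c.src, fun c c' => (c.src.tdist c'.src : ℝ), hd0, hdsymm, hdtri, hdsum, hdcmp, hdict, hvalc⟩

/-- ★ **The cube side `Mc := 1` is always admissible** (`1 ∣ sitesPerDir`): the geometry letters of GASᵇᵍ∘ v2 ∕ BGFORMᵃ∘ v2 ∕ BGFORM∘ v2 at unit cubes, for
EVERY family and level, with `κ = μ = r₁∕12`, `C = 3·K₁(3, r₁∕12)`. [cite: Balaban1987RG1, (5.10) p.293] -/
theorem exists_cellGeometry_one (r₁ : ℝ) (hr₁ : 0 < r₁) :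
    ∃ (κ μ C : ℝ), 0 < κ ∧ 0 ≤ μ ∧ ∀ (F : T3Family) (J : ℕ),
      ∃ (Ncb : ℕ) (_ : NeZero Ncb) (ecb : PBond (F.P J) 0 → TPt 3 (Ncb * 1)) (d : PBond (F.P J) 0 → PBond (F.P J) 0 → ℝ),
        (∀ x y, 0 ≤ d x y) ∧ (∀ x y, d x y = d y x) ∧ (∀ x y z, d x z ≤ d x y + d y z) ∧
        (∀ x, ∑ y, Real.exp (-(μ * d x y)) ≤ C) ∧
        (∀ b b' : PBond (F.P J) 0, κ * (b.src.tdist b'.src : ℝ) ≤ μ * d b b') ∧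
        (∀ c c' : PBond (F.P J) 0, 2 * μ * d c c' ≤ (r₁ / 2 / (((1 : ℕ) : ℝ) * 3)) * pl1 (ecb c - ecb c')) ∧
        (∀ c : PBond (F.P J) 0, ∀ i : Fin 3, (ecb c i).val = (c.src i).val) := by
  obtain ⟨κ, μ, C, hκ, hμ, h⟩ := exists_cellGeometry 1 r₁ hr₁
  exact ⟨κ, μ, C, hκ, hμ, fun F J => h F J (one_dvd _)⟩

end Summit.QuantumFields.YangMills.Theorems.FluctuationComparisonRegPrIntLBackgroundFormCellGeometry

end
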